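import Summits.Ventures.PercRepro.RankLevelSetCoreExplicit
import Summits.Ventures.PercRepro.RankLevelSetFiniteReduction

/-!
# PercRepro — THEOREM C∞ on the core with SHARPER explicit thresholds: `p ≥ 27 / 42 / 67` at `q = 3 / 4 / 5`
(night-1, gen 3)

`proofs/NIGHT-1-C025-induction.md` §14.11. Two losses of `RankLevelSetCoreLarge` are recovered:
* regime I counted `#{r ≤ q} ≤ Σ_{j < 2^q} C(n, j)`; with `ncard_eRk_le_le_sum_choose_mul` it is
  `≤ (q + 1)·n^q·2^{2^q − 1}`, so the threshold `N₁` drops from `45 / 109 / 256` to `27 / 42 / 67`;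
* regime II dropped the denominator `C(p + q, p)` of `Φ`; keeping it (`choose_mul_le_choose_mul_of_threshold`) the
  threshold `P₂` drops from `41 / 60 / 88` to `24 / 35 / 55`, and its monotone form `threshold_II_of_base` needs only a
  numeric base case.
* **`core_all_corank_of_thresholds'`** — the core theorem with the two sharper hypotheses;
* **`c025_core_three_sharp`** (`27 ≤ p`, `|E| ≥ p + 15`), **`c025_core_four_sharp`** (`42 ≤ p`, `|E| ≥ p + 25`),
  **`c025_core_five_sharp`** (`67 ≤ p`, `|E| ≥ p + 43`) — every finite matroid of that rank in which every element
  admits an `e`-free partition (coloops allowed) satisfies C-025 at `(p, q)`.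
Axioms: standard.
-/

open scoped Matroid

namespace PercRepro

/-- **The sharper large-corank input**: for `q + 1 ≤ p`, `2p ≤ n` and `2^{p+q}·K·(2a + 1) ≤ 4^a` (`a = p − 1 − q`),
`2^{p+q}·K·C(n, q) ≤ C(p + q, p)·C(n, p − 1)` (the denominator of `Φ` is kept). -/
theorem choose_mul_le_choose_mul_of_threshold (n p q K : ℕ) (hqp : q + 1 ≤ p) (hn : 2 * p ≤ n)
    (hT : 2 ^ (p + q) * K * (2 * (p - 1 - q) + 1) ≤ 4 ^ (p - 1 - q)) :
    2 ^ (p + q) * K * n.choose q ≤ (p + q).choose p * n.choose (p - 1) := by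
  set a := p - 1 - q with ha
  have hcb : 4 ^ a ≤ (2 * a + 1) * (n - q).choose a := by
    calc 4 ^ a ≤ (2 * a + 1) * (2 * a).choose a := Nat.four_pow_le_two_mul_add_one_mul_central_binom a
      _ ≤ (2 * a + 1) * (n - q).choose a := by
          apply Nat.mul_le_mul_left
          exact Nat.choose_le_choose a (by omega)
  have hkey : 2 ^ (p + q) * K ≤ (n - q).choose a := by
    have h1 : 2 ^ (p + q) * K * (2 * a + 1) ≤ (n - q).choose a * (2 * a + 1) := by
      calc 2 ^ (p + q) * K * (2 * a + 1) ≤ 4 ^ a := hT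
        _ ≤ (2 * a + 1) * (n - q).choose a := hcb
        _ = (n - q).choose a * (2 * a + 1) := by ring
    exact Nat.le_of_mul_le_mul_right h1 (by omega)
  have hid : n.choose (p - 1) * (p - 1).choose q = n.choose q * (n - q).choose a := by
    rw [ha, Nat.choose_mul (by omega)]
  have hpos : 0 < (p - 1).choose q := Nat.choose_pos (by omega)
  have hle : (p - 1).choose q ≤ (p + q).choose p := by
    rw [Nat.choose_symm_add]
    exact Nat.choose_le_choose q (by omega)
  have h2 : 2 ^ (p + q) * K * n.choose q * (p - 1).choose q ≤
      (p + q).choose p * n.choose (p - 1) * (p - 1).choose q := by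
    calc 2 ^ (p + q) * K * n.choose q * (p - 1).choose q
        = n.choose q * (p - 1).choose q * (2 ^ (p + q) * K) := by ring
      _ ≤ n.choose q * (p + q).choose p * (n - q).choose a := by
          apply Nat.mul_le_mul
          · exact Nat.mul_le_mul_left _ hle
          · exact hkey
      _ = (p + q).choose p * (n.choose q * (n - q).choose a) := by ring
      _ = (p + q).choose p * (n.choose (p - 1) * (p - 1).choose q) := by rw [hid]
      _ = (p + q).choose p * n.choose (p - 1) * (p - 1).choose q := by ring
  exact Nat.le_of_mul_le_mul_right h2 hpos

/-- **The regime-II threshold is monotone**: if `2^{P+q}·K·(2(P − 1 − q) + 1) ≤ 4^{P − 1 − q}` for one `P ≥ q + 2`, it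
holds for every `p ≥ P` (each step doubles the left side at most by `2·(2a+3)/(2a+1) ≤ 4`, the right side by `4`). -/
theorem threshold_II_of_base (q K P : ℕ) (hP : q + 2 ≤ P)
    (h0 : 2 ^ (P + q) * K * (2 * (P - 1 - q) + 1) ≤ 4 ^ (P - 1 - q)) :
    ∀ p, P ≤ p → 2 ^ (p + q) * K * (2 * (p - 1 - q) + 1) ≤ 4 ^ (p - 1 - q) := by
  intro p hp
  induction p, hp using Nat.le_induction with
  | base => exact h0
  | succ p hp ih =>
    have ha : p + 1 - 1 - q = (p - 1 - q) + 1 := by omega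
    have ha1 : 1 ≤ p - 1 - q := by omega
    rw [ha, pow_succ, show p + 1 + q = (p + q) + 1 by omega, pow_succ]
    calc 2 ^ (p + q) * 2 * K * (2 * (p - 1 - q + 1) + 1)
        = 2 ^ (p + q) * K * (2 * (2 * (p - 1 - q) + 3)) := by ring
      _ ≤ 2 ^ (p + q) * K * (4 * (2 * (p - 1 - q) + 1)) := Nat.mul_le_mul_left _ (by omega)
      _ = 4 * (2 ^ (p + q) * K * (2 * (p - 1 - q) + 1)) := by ring
      _ ≤ 4 * 4 ^ (p - 1 - q) := Nat.mul_le_mul_left 4 ih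
      _ = 4 ^ (p - 1 - q) * 4 := by ring

namespace ThmN

open Set

variable {α : Type}

/-- **Regime II arithmetic, sharper**: from `Φ ≤ 2^{p+q}/C(p+q, p)`, `U ≤ C(n, q)·K`,
`2^{p+q}·K·C(n, q) ≤ C(p+q, p)·C(n, p − 1)` and `C(n, p − 1) ≤ Y`: `Φ·U ≤ Y`. -/
theorem coreSharp_arith_II {n p q K : ℕ} {Φ U Y : ℚ}
    (hΦ : Φ ≤ (2 ^ (p + q) : ℚ) / ((p + q).choose p : ℚ)) (hU0 : 0 ≤ U)
    (hU : U ≤ (n.choose q : ℚ) * K)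
    (hkey : 2 ^ (p + q) * K * n.choose q ≤ (p + q).choose p * n.choose (p - 1))
    (hY : (n.choose (p - 1) : ℚ) ≤ Y) : Φ * U ≤ Y := by
  have hc : (0 : ℚ) < ((p + q).choose p : ℚ) := by exact_mod_cast Nat.choose_pos (Nat.le_add_right p q)
  have hkey' : (2 : ℚ) ^ (p + q) * K * (n.choose q : ℚ) ≤ ((p + q).choose p : ℚ) * (n.choose (p - 1) : ℚ) := by
    exact_mod_cast hkey
  calc Φ * U ≤ (2 ^ (p + q) : ℚ) / ((p + q).choose p : ℚ) * ((n.choose q : ℚ) * K) :=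
        mul_le_mul hΦ hU hU0 (by positivity)
    _ = (2 ^ (p + q) * K * (n.choose q : ℚ)) / ((p + q).choose p : ℚ) := by ring
    _ ≤ (((p + q).choose p : ℚ) * (n.choose (p - 1) : ℚ)) / ((p + q).choose p : ℚ) :=
        div_le_div_of_nonneg_right hkey' hc.le
    _ = (n.choose (p - 1) : ℚ) := by field_simp
    _ ≤ Y := hY

/-- **THEOREM C∞, THE CORE, WITH THE SHARPER THRESHOLDS**: if `8(q+1)·2^{2^q − 1}·n^q ≤ 2^n` for all `n ≥ N₁` and
`2^{p+q}·2^{2^q − 1}·(2(p − 1 − q) + 1) ≤ 4^{p − 1 − q}` for all `p ≥ P₂`, then every finite matroid of rank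
`p ≥ max N₁ P₂ (2^q + 2)` with an `e`-free partition for every element and `|E| > p + 2q + 2^q` satisfies
`Φ(p, q)·#U(p, q) ≤ #Y(p, q)`. -/
theorem core_all_corank_of_thresholds' (q : ℕ) (hq : 2 ≤ q) (N₁ P₂ : ℕ)
    (hN₁ : ∀ n, N₁ ≤ n → 8 * (q + 1) * 2 ^ (2 ^ q - 1) * n ^ q ≤ 2 ^ n)
    (hP₂ : ∀ p, P₂ ≤ p → 2 ^ (p + q) * 2 ^ (2 ^ q - 1) * (2 * (p - 1 - q) + 1) ≤ 4 ^ (p - 1 - q)) :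
    ∀ {α : Type} (M : Matroid α) [M.Finite] (p : ℕ), max (max N₁ P₂) (2 ^ q + 2) ≤ p → M.eRank = (p : ℕ∞) →
      p + (2 * q + 2 ^ q) < M.E.ncard →
      (∀ e ∈ M.E, ∃ A ⊆ M.E \ {e}, e ∉ M.closure A ∧ e ∉ M.closure ((M.E \ {e}) \ A)) → RLS M p q := by
  classical
  intro α M _ p hP hR hbig hfree
  set n := M.E.ncard with hn_def
  have hEcard : M.ground_finite.toFinset.card = n := by
    rw [hn_def, Set.ncard_eq_toFinset_card _ M.ground_finite]
  have hq2 : 2 * q ≤ 2 ^ q := by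
    have : q ≤ 2 ^ (q - 1) := by
      calc q = (q - 1) + 1 := by omega
        _ ≤ 2 ^ (q - 1) := Nat.lt_two_pow_self
    calc 2 * q ≤ 2 * 2 ^ (q - 1) := by omega
      _ = 2 ^ (q - 1 + 1) := by ring
      _ = 2 ^ q := by congr 1; omega
  have hpP : 2 ^ q + 2 ≤ p := le_trans (le_max_right _ _) hP
  have hN₁p : N₁ ≤ p := le_trans (le_max_left _ _) (le_trans (le_max_left _ _) hP)
  have hP₂p : P₂ ≤ p := le_trans (le_max_right _ _) (le_trans (le_max_left _ _) hP)
  have hpn : p ≤ n := by omega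
  have hU : Matroid.topCount M p q ≤ n.choose q * 2 ^ (2 ^ q - 1) := by
    calc Matroid.topCount M p q ≤ Matroid.levelCount M q := Matroid.topCount_le_levelCount_bot p q
      _ = {X : Set α | X ⊆ M.E ∧ M.eRk X = q}.ncard := rfl
      _ ≤ n.choose q * 2 ^ (2 ^ q - 1) := by rw [← hEcard]; exact ncard_eRk_eq_le_choose_mul M hfree q
  have hΦ := phiK_le_two_pow_div p q
  have hU0 : (0 : ℚ) ≤ (Matroid.topCount M p q : ℚ) := by positivity
  have hUq : (Matroid.topCount M p q : ℚ) ≤ (n.choose q : ℚ) * 2 ^ (2 ^ q - 1) := by exact_mod_cast hU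
  rw [RLS_iff]
  rcases Nat.lt_or_ge n (2 * p) with hsmall | hlarge
  · -- REGIME I with the sharper low-rank count
    have hd : M.E.encard = M.eRank + ((n - p : ℕ) : ℕ∞) := by
      rw [hR, ← M.ground_finite.cast_ncard_eq]
      norm_cast
      omega
    have hY := Matroid.two_pow_le_midCount_add (M := M) p q hR
    have hA := ncard_eRk_le_le_sum_choose_mul M hfree q
    have hB := Matroid.ncard_spanning_le (M := M) hd
    rw [hEcard] at hY hA hB
    have hA' : (∑ j ∈ Finset.range (q + 1), n.choose j) * 2 ^ (2 ^ q - 1) ≤ 2 ^ (n - 3) := by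
      have h1 := sum_choose_le_mul_pow n q (by omega)
      have h2 := hN₁ n (by omega)
      have h3 : 2 ^ n = 2 ^ (n - 3) * 8 := by
        rw [show (8 : ℕ) = 2 ^ 3 by norm_num, ← pow_add]; congr 1; omega
      have h5 : 8 * ((∑ j ∈ Finset.range (q + 1), n.choose j) * 2 ^ (2 ^ q - 1)) ≤ 8 * 2 ^ (n - 3) := by
        calc 8 * ((∑ j ∈ Finset.range (q + 1), n.choose j) * 2 ^ (2 ^ q - 1))
            ≤ 8 * (((q + 1) * n ^ q) * 2 ^ (2 ^ q - 1)) := by gcongr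
          _ = 8 * (q + 1) * 2 ^ (2 ^ q - 1) * n ^ q := by ring
          _ ≤ 2 ^ n := h2
          _ = 8 * 2 ^ (n - 3) := by rw [h3]; ring
      exact Nat.le_of_mul_le_mul_left h5 (by norm_num)
    have hB' : ∑ j ∈ Finset.range (n - p + 1), n.choose j ≤ 2 ^ (n - 1) :=
      sum_choose_le_two_pow_pred n (n - p) (by omega)
    have hCn : n.choose q ≤ 2 ^ q * (p + q).choose p := by
      rw [Nat.choose_symm_add]
      exact choose_le_two_pow_mul_choose n p q (by omega)
    have hYq : (2 : ℚ) ^ n ≤ (Matroid.midCount M p q : ℚ) + ({X : Set α | X ⊆ M.E ∧ M.eRk X ≤ q}.ncard : ℚ) +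
        ({X : Set α | X ⊆ M.E ∧ M.eRk X = M.eRank}.ncard : ℚ) := by exact_mod_cast hY
    have hAq : ({X : Set α | X ⊆ M.E ∧ M.eRk X ≤ q}.ncard : ℚ) ≤ 2 ^ (n - 3) := by
      exact_mod_cast hA.trans hA'
    have hBq : ({X : Set α | X ⊆ M.E ∧ M.eRk X = M.eRank}.ncard : ℚ) ≤ 2 ^ (n - 1) := by
      exact_mod_cast hB.trans hB'
    have hCnq : (n.choose q : ℚ) ≤ 2 ^ q * ((p + q).choose p : ℚ) := by exact_mod_cast hCn
    exact coreLarge_arith_I hq (by omega) hΦ hU0 hUq hCnq hYq hAq hBq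
  · -- REGIME II with the denominator of `Φ` kept
    have hY := choose_le_midCount_of_two_pow_le M hfree (p := p) (q := q) (by omega) (by omega)
    rw [hEcard] at hY
    have hkey := choose_mul_le_choose_mul_of_threshold n p q (2 ^ (2 ^ q - 1)) (by omega) hlarge (hP₂ p hP₂p)
    have hYq : (n.choose (p - 1) : ℚ) ≤ (Matroid.midCount M p q : ℚ) := by exact_mod_cast hY
    have hUq' : (Matroid.topCount M p q : ℚ) ≤ (n.choose q : ℚ) * ((2 ^ (2 ^ q - 1) : ℕ) : ℚ) := by
      exact_mod_cast hU
    exact coreSharp_arith_II hΦ hU0 hUq' hkey hYq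

/-- **The core at `q = 3`, sharp**: rank `p ≥ 27`, `e`-free partitions, `|E| ≥ p + 15` ⇒ C-025 at `(p, 3)`. -/
theorem c025_core_three_sharp (M : Matroid α) [M.Finite] (p : ℕ) (hp : 27 ≤ p) (hR : M.eRank = (p : ℕ∞))
    (hbig : p + 14 < M.E.ncard)
    (hfree : ∀ e ∈ M.E, ∃ A ⊆ M.E \ {e}, e ∉ M.closure A ∧ e ∉ M.closure ((M.E \ {e}) \ A)) : RLS M p 3 := by
  have hN₁ : ∀ n, 27 ≤ n → 8 * (3 + 1) * 2 ^ (2 ^ 3 - 1) * n ^ 3 ≤ 2 ^ n :=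
    mul_pow_le_two_pow_of_base (8 * (3 + 1) * 2 ^ (2 ^ 3 - 1)) 3 27 (by norm_num) (by norm_num) (by norm_num)
  have hP₂ := threshold_II_of_base 3 (2 ^ (2 ^ 3 - 1)) 24 (by norm_num) (by norm_num)
  have hmax : max (max 27 24) (2 ^ 3 + 2) = 27 := by decide
  refine core_all_corank_of_thresholds' 3 (by norm_num) 27 24 hN₁ hP₂ M p (by rw [hmax]; exact hp) hR ?_ hfree
  norm_num
  exact hbig

/-- **The core at `q = 4`, sharp**: rank `p ≥ 42`, `e`-free partitions, `|E| ≥ p + 25` ⇒ C-025 at `(p, 4)`. -/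
theorem c025_core_four_sharp (M : Matroid α) [M.Finite] (p : ℕ) (hp : 42 ≤ p) (hR : M.eRank = (p : ℕ∞))
    (hbig : p + 24 < M.E.ncard)
    (hfree : ∀ e ∈ M.E, ∃ A ⊆ M.E \ {e}, e ∉ M.closure A ∧ e ∉ M.closure ((M.E \ {e}) \ A)) : RLS M p 4 := by
  have hN₁ : ∀ n, 42 ≤ n → 8 * (4 + 1) * 2 ^ (2 ^ 4 - 1) * n ^ 4 ≤ 2 ^ n :=
    mul_pow_le_two_pow_of_base (8 * (4 + 1) * 2 ^ (2 ^ 4 - 1)) 4 42 (by norm_num) (by norm_num) (by norm_num)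
  have hP₂ := threshold_II_of_base 4 (2 ^ (2 ^ 4 - 1)) 35 (by norm_num) (by norm_num)
  have hmax : max (max 42 35) (2 ^ 4 + 2) = 42 := by decide
  refine core_all_corank_of_thresholds' 4 (by norm_num) 42 35 hN₁ hP₂ M p (by rw [hmax]; exact hp) hR ?_ hfree
  norm_num
  exact hbig

/-- **The core at `q = 5`, sharp**: rank `p ≥ 67`, `e`-free partitions, `|E| ≥ p + 43` ⇒ C-025 at `(p, 5)`. -/
theorem c025_core_five_sharp (M : Matroid α) [M.Finite] (p : ℕ) (hp : 67 ≤ p) (hR : M.eRank = (p : ℕ∞))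
    (hbig : p + 42 < M.E.ncard)
    (hfree : ∀ e ∈ M.E, ∃ A ⊆ M.E \ {e}, e ∉ M.closure A ∧ e ∉ M.closure ((M.E \ {e}) \ A)) : RLS M p 5 := by
  have hN₁ : ∀ n, 67 ≤ n → 8 * (5 + 1) * 2 ^ (2 ^ 5 - 1) * n ^ 5 ≤ 2 ^ n :=
    mul_pow_le_two_pow_of_base (8 * (5 + 1) * 2 ^ (2 ^ 5 - 1)) 5 67 (by norm_num) (by norm_num) (by norm_num)
  have hP₂ := threshold_II_of_base 5 (2 ^ (2 ^ 5 - 1)) 55 (by norm_num) (by norm_num)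
  have hmax : max (max 67 55) (2 ^ 5 + 2) = 67 := by decide
  refine core_all_corank_of_thresholds' 5 (by norm_num) 67 55 hN₁ hP₂ M p (by rw [hmax]; exact hp) hR ?_ hfree
  norm_num
  exact hbig

end ThmN

end PercRepro
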